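import Summits.Ventures.CertifiedQuantumChemistry.Certificates.HubbardRingL4U100DQGGapTables
import HarnessLib

/-!
# Ventures/CertifiedQuantumChemistry — Certificates/HubbardRingL4U100DQGGapQ.lean: the `Q`-condition kernel run of the
# `U = 100` strict-gap certificate of the half-filled Hubbard 4-ring (data in `…GapTables.lean`, theorems in `…Gap.lean`)

HONEST FRAMING (verbatim): certified bounds for a stated model Hamiltonian in a stated basis; not a
claim about the real molecule beyond that model.

Seat rdm-B (gen 40). One kernel statement, split out of the `U = 100` certificate so that every file of the chain
elaborates well within the farm's wall limit (one `64 × 64` exact `LDLᵀ` run ≈ 2–3 min of kernel time): the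
precomputed integer table `gapL4U100Qz/den` IS Mazziotti's `Q`-map of the pair `(gapL4U100g, gapL4U100G)/den`
(all `4096` entries, kernel evaluation), and it is symmetric and ACCEPTED by `ExactLDL.ldlAccept` (rank `28`).
Nothing is asserted about any energy here. 0 sorry, 0 def, standard axioms.
-/

namespace Summit.Ventures.CertifiedQuantumChemistry

namespace DQGGap

/-- The precomputed table IS the `Q`-map of the pair (all `64 × 64` entries, kernel evaluation). -/
theorem ringL4U100_Q_tab :
    toFin (qMapQ (gamQ gapL4U100den gapL4U100g) (GamQ gapL4U100den gapL4U100G)) = toFin (GamQ gapL4U100den gapL4U100Qz) := by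
  decide +kernel

/-- `Q`-condition by the kernel: `Q(γ, Γ)` is symmetric and ACCEPTED by the exact `LDLᵀ` routine (rank `28`). -/
theorem ringL4U100_ldl_Q :
    (toFin (qMapQ (gamQ gapL4U100den gapL4U100g) (GamQ gapL4U100den gapL4U100G))).IsSymm ∧
      ExactLDL.ldlAccept (4 * 2 * (4 * 2)) (toFin (qMapQ (gamQ gapL4U100den gapL4U100g) (GamQ gapL4U100den gapL4U100G))) = true := by
  rw [ringL4U100_Q_tab]
  constructor <;> decide +kernel


end DQGGap

end Summit.Ventures.CertifiedQuantumChemistry
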